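/-
Copyright (c) 2026 the pub-hodgecm-mathlib formalisation cell (harness21).  Prover seat hodgecm-mathlib-R90-C133-p03 (g3), Track B ∕ K2-LIT ∕ R90-TF section S5
(Rogawski Ch. 13.3 ∕ §14.6); deal (H9) of the S5 dealer R90-C133-plan (g2) 2026-09-05T01:18:50Z (CENSUS-γ §5 (3)): the ASSEMBLY «pinned constituents ⟹ `MemXiFamily`».
-/
import Literature.NumberTheory.Rogawski1990.GlobalAPacketMembership                        -- ★ D6: `MemXiFamily`, `IsXiLocalFamily`, `LocalConstituentsIn`, `cmSplitPacket`, `splitWitness`; ★ `KeysCaseTwoLabels`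
import Summits.HodgeConjecture.HodgeConjecture.Theorems.R90S9FlathOfAnisotropic             -- ★ p861871 `automorphicFlathAdmissible_of_anisotropic` (AFA at anisotropic `H`); brings ★ `exists_cmOccursInDiscreteSpectrum_of_hasFinComponent`, ★ `smoothConstituents_iff_of_hasFinComponent`
import HarnessLib

/-!
# R90-TF · S5 — `R90S5MemXiFamilyOfPinnedConstituents`: «PINNED LOCAL CONSTITUENTS AT EVERY FINITE PLACE ⟹ `P` LIES IN THE ξ-ENVELOPE `MemXiFamily P … ξ`» — the S-sized
# ASSEMBLY between the §14.6 rigidity organ's pinned conclusion and the D6 envelope (Rogawski 1990, Thm. 14.6.4 pp. 243–244; §13.1 p. 199, Prop. 13.1.3 (d); §12.2 (2) p. 174)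

Cell `hodgecm-mathlib`, crux H413 (`stmt-HodgeConjecture-24833`), route of record `HCCMUnconditional`; programme R90-TF, section S5 (Rogawski Ch. 13.3); deal (H9) (S5 dealer
R90-C133-plan (g2), FOUR SHORT RULINGS 2026-09-05T01:18:50Z (1), spec = CENSUS-γ §5 (3)), hand R90-C133-p03 (g3).  THEOREMS ONLY (`--kind proof --supports
stmt-HodgeConjecture-24833 --as helper`): no `def`, no instance, no notation, no named fact, no `sorry`, NO `Lines` import; reads no archimedean slot (LAW NO-INF).

WHY.  The (γ) letter of the `₃` road ends in ★ D6 `MemXiFamily P hH hHd μω hμu ξ := ∃ Pv, ξ.IsXiLocalFamily hH hHd μω hμu Pv ∧ LocalConstituentsIn P Pv` (an ENVELOPE, finite places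
only), while the §14.6 organ (S9-B (B4b) `SocketDefiniteAeRigidity`, CENSUS-γ row (γ2)) concludes print's PINNED form place by place: at a non-split `v` every `v`-constituent of
`P` is `πⁿ(ξ_v) ∘ e`, `π²(ξ_v) ∘ e` or a supercuspidal `πˢ` [Thm. 14.6.4 p. 244 «`Π′(ξ)_v = Π(ξ_v)` for `v ∉ S₀`»; Prop. 13.1.3 (d): `πˢ(ξ_v)` supercuspidal; §12.2 (2) p. 174:
`JH(i_G(χ_ξ)) = {πⁿ, π²}`], at a split `v` it is the member of the split packet `{i_G(ξ_v ⊗ μ_w ∘ det₀)}` [§13.3 p. 201; §4.13 L. 4.13.1 (b)].  THIS FILE assembles the envelope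
from such pins: §1 for an ABSTRACT pin (one class `x ∈ JH(i_G(χ_ξ))` along one form congruence + an optional supercuspidal, per non-split place — the (M2-nonsplit) clause of
★ `IsXiLocalFamily` read as a hypothesis on `P`'s constituents), §2 «one constituent class per place» for `P` with an irreducible admissible finite component (Flath ★) — in
particular for EVERY discrete `P` of `U(H)` with `H` ANISOTROPIC (★ `automorphicFlathAdmissible_of_anisotropic`; A's frame: `H` definite at some complex place), §3 the
TRICHOTOMY form: Keys labels `(π², πⁿ)` of `i_G(χ_ξ,v)` (★ `KeysCaseTwoLabels`) + «every constituent is `πⁿ ∘ e` ∨ `π² ∘ e` ∨ supercuspidal» at non-split `v` + membership in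
the reference family `Ξ₀ v` at split `v` (the split packet of record) ⟹ `MemXiFamily`, with and without the anisotropy discharge.
CONTENTS (namespace `Summit.HodgeConjecture.HodgeConjecture.R90.S5`):
* §1 `memXiFamily_of_pinnedAt` — (PIN-S) + (PIN-N) ⟹ `MemXiFamily`, relative to a REFERENCE ξ-local family `Ξ₀` (record: ★ `xiPacketFamilyOfRecordSCD … ξ`): the family `Pv` is
  `Ξ₀ v` (= the split packet) at split `v`, the pinned pair `⟨x ∘ e, s⟩` at non-split `v`.
* §2 `exists_forall_isConstituentOf_iff_of_hasFinComponent`, `exists_forall_isConstituentOf_iff_of_anisotropic` — ONE class per place (Flath ★ + AFA ★).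
* §3 `memXiFamily_of_keysTrichotomy_of_constituentClass` (given the class family), `memXiFamily_of_keysTrichotomy_of_hasFinComponent`, and the anisotropic head
  `memXiFamily_of_keysTrichotomy_of_anisotropic` — the form (γ2)'s payer hands over: (B4b)'s non-split trichotomy with «`πˢ` supercuspidal» in place of the named `πˢ` + split pins.
HONEST LABEL: bookkeeping between two currencies; proves no rigidity and no character identity — (γ2) (S9, XL) and (γ1) (S4 kit law) are untouched; REL ≠ ★ ≠ BUILT; HC_CM is proved
only modulo the 7 printed citations (2 remaining named inputs: hLiu418 = stmt-HodgeConjecture-24832, h413 = stmt-HodgeConjecture-24833) until rung 0 closes.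

## References
* [Rogawski1990] J. D. Rogawski, *Automorphic Representations of Unitary Groups in Three Variables*, Ann. of Math. Stud. 123 (1990), §4.13 p. 62, Lemma 4.13.1 (b); §12.2 (2)
  pp. 173–174; §13.1 p. 199, Prop. 13.1.3 (d); §13.3 p. 201; §14.2 p. 232; §14.5 p. 237; §14.6 Thm. 14.6.4 pp. 243–244.
* [FlathCorvallis1979] D. Flath, *Decomposition of representations into tensor products*, Proc. Sympos. Pure Math. 33.1 (1979), Thm. 3 and Thm. 4.
* [KeysShahidi1988] C. D. Keys, F. Shahidi, *Artin L-functions and normalization of intertwining operators*, Ann. Sci. ÉNS 21 (1988) (reducibility labels of `i_G(χ)`).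
-/

set_option autoImplicit false
set_option linter.dupNamespace false -- the mandated namespace repeats `HodgeConjecture.HodgeConjecture`, as in every sibling `R90S5*` file

noncomputable section

open NumberField IsDedekindDomain MeasureTheory Filter
open scoped Matrix
open Literature.NumberTheory Literature.NumberTheory.Automorphic Literature.NumberTheory.Automorphic.UnitaryGroup
open Literature.NumberTheory.Rogawski1990 Literature.NumberTheory.GaloisRepresentations

namespace Summit.HodgeConjecture.HodgeConjecture.R90.S5

open Summit.HodgeConjecture.HodgeConjecture.Cruxes.H413.F0P3GlobalPacketDiscrete
open Summit.HodgeConjecture.HodgeConjecture.Cruxes.H413.F0P3FinPartConstituentTransfer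
open Summit.HodgeConjecture.HodgeConjecture.R90.S9

variable (L : Type) [Field L] [NumberField L] [IsCMField L] (H : Matrix (Fin 3) (Fin 3) L)
  (hH : (H.map (cmConjRingHom L))ᵀ = H) (hHd : IsUnit H.det) (μω : HeckeCharacter L) (hμu : μω.IsUnitary)
  {μA : Measure (adelicGroupData (↥(maximalRealSubfield L)) L (IsCMField.complexConj L) 3 H).automorphicQuotient}
  [(adelicGroupData (↥(maximalRealSubfield L)) L (IsCMField.complexConj L) 3 H).IsAutomorphicMeasure μA]

/-! ## §1 The assembly from an abstract per-place pin [Thm. 14.6.4 p. 244; §13.1 p. 199; §13.3 p. 201] -/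

set_option maxHeartbeats 400000 in -- measured ≤ 60k by `#count_heartbeats`; the default budget trips on this toolchain's accounting for the large binder types
/-- **PINNED CONSTITUENTS ⟹ `MemXiFamily`** — the D6 envelope assembled place by place, relative to a REFERENCE ξ-local family `Ξ₀` (`hΞ₀ : ξ.IsXiLocalFamily hH hHd μω hμu Ξ₀`;
at the record `Ξ₀ := xiPacketFamilyOfRecordSCD … ξ`, ★ `isXiLocalFamily_xiPacketFamilyOfRecordSCD` — at a split `v`, `Ξ₀ v` IS ξ's split packet at the fixed witness by (M2-split),
★ `xiPacketFamilyOfRecordSCD_of_split`).  (PIN-S): at every place `v` SPLIT in `L`, every `v`-constituent of `P` (D6 currency: classes of `U(H)(L⁺_v)` whose pull-back along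
★ `localPiEquiv v` is a constituent of `P^∞|_{U(H)(𝔸_f)} ∘ inclPlace v`) is a member of `Ξ₀ v`.  (PIN-N): at every NON-SPLIT `v` there are a form congruence
`e⁻¹ = cmDatumLocalCongr L v T ha h`, ONE class `x` of `U(Φ₃)(L⁺_v)` that is a constituent of `i_G(χ_{ξ,v})` (★ `cmPrincipalSeries … (cmXiTorusChar …)`) and an optional class
`s`, supercuspidal if present, such that every `v`-constituent of `P` is `x ∘ e` or `s` (the (M2-nonsplit) clause of ★ `IsXiLocalFamily` read as a pin).  Then `P` lies in the
ξ-envelope: the family is `Ξ₀ v` at split `v` and `⟨x ∘ e, s⟩` at non-split `v`. [cite: Rogawski1990, §14.6 Thm. 14.6.4 p. 244; §13.1 p. 199, Prop. 13.1.3 (d); §13.3 p. 201; §12.2 (2) p. 174; §14.2 p. 232] -/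
theorem memXiFamily_of_pinnedAt (ξ : OneDimAutRepH L)
    (Ξ₀ : ∀ v : HeightOneSpectrum (𝓞 ↥(maximalRealSubfield L)), CMLocalAPacket L H v) (hΞ₀ : ξ.IsXiLocalFamily hH hHd μω hμu Ξ₀)
    (P : DiscreteAutomorphicRep (adelicGroupData (↥(maximalRealSubfield L)) L (IsCMField.complexConj L) 3 H) μA)
    (hS : ∀ (v : HeightOneSpectrum (𝓞 ↥(maximalRealSubfield L))) (hs : ∃ w : PlacesOver L v, IsCMField.complexConj L • w.1 ≠ w.1)
      (c : IrrClass ((cmDatum L 3 H).Local v)),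
      (IrrClass.comap (localPiEquiv L (IsCMField.complexConj L) 3 H v) c).IsConstituentOf
          (P.finRep.smoothPart.toRepresentation.comp (inclPlace (↥(maximalRealSubfield L)) L (IsCMField.complexConj L) 3 H v)) →
        c ∈ (Ξ₀ v).members)
    (hN : ∀ (v : HeightOneSpectrum (𝓞 ↥(maximalRealSubfield L))), (∀ w : PlacesOver L v, IsCMField.complexConj L • w.1 = w.1) →
      ∃ (T : GL (Fin 3) (LocalRing L v)) (a : LocalRing L v) (ha : IsUnit a)
        (h : formCongr (conjLocal L (IsCMField.complexConj L) v) T (H.map (algebraMap L (LocalRing L v))) =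
          a • (Matrix.of fun i j : Fin 3 => if i.val + j.val + 1 = 3 then (1 : L) else 0).map (algebraMap L (LocalRing L v)))
        (x : IrrClass (Gqs L v)) (s : Option (IrrClass ((cmDatum L 3 H).Local v))),
        x.IsConstituentOf (cmPrincipalSeries L 3 v (cmXiTorusChar L v (μω.semilocalComponent L v)
          (torusLocalComponent L (IsCMField.complexConj L) v ξ.η) (torusLocalComponent L (IsCMField.complexConj L) v ξ.ψ))) ∧
        (∀ c : IrrClass ((cmDatum L 3 H).Local v), s = some c → c.IsSupercuspidal) ∧
        ∀ c : IrrClass ((cmDatum L 3 H).Local v),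
          (IrrClass.comap (localPiEquiv L (IsCMField.complexConj L) 3 H v) c).IsConstituentOf
              (P.finRep.smoothPart.toRepresentation.comp (inclPlace (↥(maximalRealSubfield L)) L (IsCMField.complexConj L) 3 H v)) →
            c = IrrClass.comap (cmDatumLocalCongr L v T ha h).symm x ∨ s = some c) :
    MemXiFamily P hH hHd μω hμu ξ := by
  -- place by place, a local A-packet datum `p` carrying the three clauses (split equation ∕ non-split pin ∕ membership); NO `dite` (kernel-light)
  have hfam : ∀ v : HeightOneSpectrum (𝓞 ↥(maximalRealSubfield L)), ∃ p : CMLocalAPacket L H v,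
      ((∃ w : PlacesOver L v, IsCMField.complexConj L • w.1 ≠ w.1) → p = Ξ₀ v) ∧
      ((∀ w : PlacesOver L v, IsCMField.complexConj L • w.1 = w.1) →
        ∃ (T : GL (Fin 3) (LocalRing L v)) (a : LocalRing L v) (ha : IsUnit a)
          (h : formCongr (conjLocal L (IsCMField.complexConj L) v) T (H.map (algebraMap L (LocalRing L v))) =
            a • (Matrix.of fun i j : Fin 3 => if i.val + j.val + 1 = 3 then (1 : L) else 0).map (algebraMap L (LocalRing L v)))
          (x : IrrClass (Gqs L v)) (s : Option (IrrClass ((cmDatum L 3 H).Local v))),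
          p = ⟨IrrClass.comap (cmDatumLocalCongr L v T ha h).symm x, s⟩ ∧
          x.IsConstituentOf (cmPrincipalSeries L 3 v (cmXiTorusChar L v (μω.semilocalComponent L v)
            (torusLocalComponent L (IsCMField.complexConj L) v ξ.η) (torusLocalComponent L (IsCMField.complexConj L) v ξ.ψ))) ∧
          ∀ c : IrrClass ((cmDatum L 3 H).Local v), s = some c → c.IsSupercuspidal) ∧
      ∀ c : IrrClass ((cmDatum L 3 H).Local v),
        (IrrClass.comap (localPiEquiv L (IsCMField.complexConj L) 3 H v) c).IsConstituentOf
            (P.finRep.smoothPart.toRepresentation.comp (inclPlace (↥(maximalRealSubfield L)) L (IsCMField.complexConj L) 3 H v)) →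
          c ∈ p.members := by
    intro v
    by_cases hs₀ : ∃ w : PlacesOver L v, IsCMField.complexConj L • w.1 ≠ w.1
    · -- split place: the split packet at the fixed witness
      refine ⟨Ξ₀ v, fun _ => rfl, fun hns => ?_, fun c hc => hS v hs₀ c hc⟩
      obtain ⟨w, hw⟩ := hs₀
      exact absurd (hns w) hw
    · -- non-split place: the pinned pair `⟨x ∘ e, s⟩`
      have hns : ∀ w : PlacesOver L v, IsCMField.complexConj L • w.1 = w.1 := fun w => not_not.1 fun hw => hs₀ ⟨w, hw⟩
      obtain ⟨T, a, ha, h, x, s, hx, hsc, hmem⟩ := hN v hns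
      exact ⟨⟨IrrClass.comap (cmDatumLocalCongr L v T ha h).symm x, s⟩, fun hs => absurd hs hs₀,
        fun _ => ⟨T, a, ha, h, x, s, rfl, hx, hsc⟩, fun c hc => (LocalAPacket.mem_members_iff _ c).2 (hmem c hc)⟩
  choose Pv hPv using hfam
  exact ⟨Pv, ⟨fun v hs => ((hPv v).1 hs).trans (hΞ₀.1 v hs), fun v hns => (hPv v).2.1 hns⟩, fun v c hc => (hPv v).2.2 c hc⟩

/-! ## §2 One constituent class per place (Flath ★; AFA ★ at an anisotropic form) [§14.5 p. 237; FlathCorvallis1979 Thm. 3] -/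

set_option maxHeartbeats 400000 in -- measured ≤ 60k by `#count_heartbeats`; the default budget trips on this toolchain's accounting for the large binder types
/-- **ONE CONSTITUENT CLASS PER PLACE** for a discrete `P` with an irreducible ADMISSIBLE finite component `σ` (★ `HasFinComponent`): there is a family `π = (π_v)_v` such that at
every finite place the D6-constituents of `P` are EXACTLY `{π_v}` — the occurring family of `(P, σ)` (★ `exists_cmOccursInDiscreteSpectrum_of_hasFinComponent`) read on `P^∞`
through ★ `smoothConstituents_iff_of_hasFinComponent`. [cite: FlathCorvallis1979, Thm. 3] [cite: Rogawski1990, §14.5 p. 237; §13.3 p. 201 ¶2] -/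
theorem exists_forall_isConstituentOf_iff_of_hasFinComponent
    (P : DiscreteAutomorphicRep (adelicGroupData (↥(maximalRealSubfield L)) L (IsCMField.complexConj L) 3 H) μA)
    {W : Type} [AddCommGroup W] [Module ℂ W] {σ : Representation ℂ (finAdelic (↥(maximalRealSubfield L)) L (IsCMField.complexConj L) 3 H) W}
    (hirr : σ.IsIrreducible) (hadm : σ.IsAdmissible) (hP : P.HasFinComponent σ) :
    ∃ π : ∀ v : HeightOneSpectrum (𝓞 ↥(maximalRealSubfield L)), IrrClass ((cmDatum L 3 H).Local v),
      cmOccursInDiscreteSpectrum L 3 H μA π ∧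
      ∀ (v : HeightOneSpectrum (𝓞 ↥(maximalRealSubfield L))) (c : IrrClass ((cmDatum L 3 H).Local v)),
        (IrrClass.comap (localPiEquiv L (IsCMField.complexConj L) 3 H v) c).IsConstituentOf
            (P.finRep.smoothPart.toRepresentation.comp (inclPlace (↥(maximalRealSubfield L)) L (IsCMField.complexConj L) 3 H v)) ↔ c = π v := by
  obtain ⟨π, hπ, hiff⟩ := exists_cmOccursInDiscreteSpectrum_of_hasFinComponent L 3 H μA P hirr hadm hP
  exact ⟨π, hπ, fun v c => (smoothConstituents_iff_of_hasFinComponent P hirr hadm hP v _).trans (hiff v c)⟩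

set_option maxHeartbeats 400000 in -- measured ≤ 60k by `#count_heartbeats`; the default budget trips on this toolchain's accounting for the large binder types
/-- **ONE CONSTITUENT CLASS PER PLACE FOR EVERY DISCRETE `P` OF `U(H)`, `H` ANISOTROPIC** — «AFA» holds at an anisotropic form (★ `automorphicFlathAdmissible_of_anisotropic`:
compact quotient, Godement), so §2's first theorem applies to every `P`.  A's frame (`H` positive definite at a complex place) is anisotropic (★ `UnitaryGroup.anisotropic_of_posDef_map`).
[cite: FlathCorvallis1979, Thm. 3 and Thm. 4] [cite: Rogawski1990, §14.5 p. 237; §14.2 p. 232] -/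
theorem exists_forall_isConstituentOf_iff_of_anisotropic
    (hanis : ∀ x : Fin 3 → L, Literature.AlgebraicGeometry.ShimuraVarieties.hermForm (cmConjRingHom L) H x x = 0 → x = 0)
    (P : DiscreteAutomorphicRep (adelicGroupData (↥(maximalRealSubfield L)) L (IsCMField.complexConj L) 3 H) μA) :
    ∃ π : ∀ v : HeightOneSpectrum (𝓞 ↥(maximalRealSubfield L)), IrrClass ((cmDatum L 3 H).Local v),
      cmOccursInDiscreteSpectrum L 3 H μA π ∧
      ∀ (v : HeightOneSpectrum (𝓞 ↥(maximalRealSubfield L))) (c : IrrClass ((cmDatum L 3 H).Local v)),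
        (IrrClass.comap (localPiEquiv L (IsCMField.complexConj L) 3 H v) c).IsConstituentOf
            (P.finRep.smoothPart.toRepresentation.comp (inclPlace (↥(maximalRealSubfield L)) L (IsCMField.complexConj L) 3 H v)) ↔ c = π v := by
  obtain ⟨W, _, _, σ, hirr, hadm, hP⟩ := automorphicFlathAdmissible_of_anisotropic L 3 H hanis μA P
  exact exists_forall_isConstituentOf_iff_of_hasFinComponent L H P hirr hadm hP

/-! ## §3 The trichotomy form: Keys labels + «`πⁿ ∘ e` ∨ `π² ∘ e` ∨ supercuspidal» at non-split places [Thm. 14.6.4 p. 244; Prop. 13.1.3 (d); §12.2 (2)] -/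

set_option maxHeartbeats 400000 in -- measured ≤ 60k by `#count_heartbeats`; the default budget trips on this toolchain's accounting for the large binder types
/-- **TRICHOTOMY ON THE CONSTITUENT CLASS ⟹ `MemXiFamily`**, given the one-class-per-place family `π` of §2: (T-S) at every split `v`, `π_v` is a member of the reference family `Ξ₀ v`
(= ξ's split packet at the fixed witness); (T-N) at every non-split `v` there are a form congruence `e⁻¹` and Keys labels `(π², πⁿ)` of `i_G(χ_{ξ,v})` (★ `KeysCaseTwoLabels`: both are constituents of the
principal series) with `π_v = πⁿ ∘ e`, or `π_v = π² ∘ e`, or `π_v` SUPERCUSPIDAL — the shape the §14.6 organ delivers (S9-B (B4b), with its named `πˢ(ξ_v) ∘ e` weakened to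
«supercuspidal», Prop. 13.1.3 (d)).  The envelope's non-split member is `x := πⁿ` resp. `π²` resp. `πⁿ` with `s := none ∕ none ∕ some π_v`.
[cite: Rogawski1990, §14.6 Thm. 14.6.4 p. 244; §13.1 Prop. 13.1.3 (d) p. 199; §12.2 (2) p. 174; §13.3 p. 201] -/
theorem memXiFamily_of_keysTrichotomy_of_constituentClass (ξ : OneDimAutRepH L)
    (Ξ₀ : ∀ v : HeightOneSpectrum (𝓞 ↥(maximalRealSubfield L)), CMLocalAPacket L H v) (hΞ₀ : ξ.IsXiLocalFamily hH hHd μω hμu Ξ₀)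
    (P : DiscreteAutomorphicRep (adelicGroupData (↥(maximalRealSubfield L)) L (IsCMField.complexConj L) 3 H) μA)
    (π : ∀ v : HeightOneSpectrum (𝓞 ↥(maximalRealSubfield L)), IrrClass ((cmDatum L 3 H).Local v))
    (hπ : ∀ (v : HeightOneSpectrum (𝓞 ↥(maximalRealSubfield L))) (c : IrrClass ((cmDatum L 3 H).Local v)),
      (IrrClass.comap (localPiEquiv L (IsCMField.complexConj L) 3 H v) c).IsConstituentOf
          (P.finRep.smoothPart.toRepresentation.comp (inclPlace (↥(maximalRealSubfield L)) L (IsCMField.complexConj L) 3 H v)) ↔ c = π v)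
    (hTS : ∀ (v : HeightOneSpectrum (𝓞 ↥(maximalRealSubfield L))) (hs : ∃ w : PlacesOver L v, IsCMField.complexConj L • w.1 ≠ w.1),
      π v ∈ (Ξ₀ v).members)
    (hTN : ∀ (v : HeightOneSpectrum (𝓞 ↥(maximalRealSubfield L))), (∀ w : PlacesOver L v, IsCMField.complexConj L • w.1 = w.1) →
      ∃ (T : GL (Fin 3) (LocalRing L v)) (a : LocalRing L v) (ha : IsUnit a)
        (h : formCongr (conjLocal L (IsCMField.complexConj L) v) T (H.map (algebraMap L (LocalRing L v))) =
          a • (Matrix.of fun i j : Fin 3 => if i.val + j.val + 1 = 3 then (1 : L) else 0).map (algebraMap L (LocalRing L v)))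
        (π2 πn : IrrClass (Gqs L v)),
        KeysCaseTwoLabels L v (μω.semilocalComponent L v) (torusLocalComponent L (IsCMField.complexConj L) v ξ.η)
          (torusLocalComponent L (IsCMField.complexConj L) v ξ.ψ) π2 πn ∧
        (π v = IrrClass.comap (cmDatumLocalCongr L v T ha h).symm πn ∨ π v = IrrClass.comap (cmDatumLocalCongr L v T ha h).symm π2 ∨ (π v).IsSupercuspidal)) :
    MemXiFamily P hH hHd μω hμu ξ := by
  refine memXiFamily_of_pinnedAt L H hH hHd μω hμu ξ Ξ₀ hΞ₀ P (fun v hs c hc => ?_) fun v hns => ?_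
  · obtain rfl := (hπ v c).1 hc
    exact hTS v hs
  obtain ⟨T, a, ha, h, π2, πn, hK, htri⟩ := hTN v hns
  -- both Keys labels are constituents of the principal series `i_G(χ_{ξ,v})`
  have hπn : πn.IsConstituentOf (cmPrincipalSeries L 3 v (cmXiTorusChar L v (μω.semilocalComponent L v)
      (torusLocalComponent L (IsCMField.complexConj L) v ξ.η) (torusLocalComponent L (IsCMField.complexConj L) v ξ.ψ))) := (hK.2 πn).2 (Or.inl rfl)
  have hπ2 : π2.IsConstituentOf (cmPrincipalSeries L 3 v (cmXiTorusChar L v (μω.semilocalComponent L v)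
      (torusLocalComponent L (IsCMField.complexConj L) v ξ.η) (torusLocalComponent L (IsCMField.complexConj L) v ξ.ψ))) := (hK.2 π2).2 (Or.inr rfl)
  rcases htri with hn | h2 | hsc
  · exact ⟨T, a, ha, h, πn, none, hπn, fun c hc' => absurd hc'.symm (Option.some_ne_none c), fun c hc' => Or.inl (((hπ v c).1 hc').trans hn)⟩
  · exact ⟨T, a, ha, h, π2, none, hπ2, fun c hc' => absurd hc'.symm (Option.some_ne_none c), fun c hc' => Or.inl (((hπ v c).1 hc').trans h2)⟩
  · refine ⟨T, a, ha, h, πn, some (π v), hπn, fun c hc' => ?_, fun c hc' => Or.inr (congrArg some ((hπ v c).1 hc').symm)⟩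
    cases hc'
    exact hsc

set_option maxHeartbeats 400000 in -- measured ≤ 60k by `#count_heartbeats`; the default budget trips on this toolchain's accounting for the large binder types
/-- **THE TRICHOTOMY FORM FOR A `P` WITH AN IRREDUCIBLE ADMISSIBLE FINITE COMPONENT**, stated on ALL constituents (no class family in the signature): (T-S) every split-place constituent lies in
the reference family `Ξ₀ v` (ξ's split packet); (T-N) at every non-split `v`, for some frame and Keys labels, EVERY constituent is `πⁿ ∘ e` ∨ `π² ∘ e` ∨ supercuspidal.  (§2 supplies the class family; the two forms
agree on it.) [cite: Rogawski1990, §14.6 Thm. 14.6.4 p. 244; §13.1 Prop. 13.1.3 (d) p. 199; §12.2 (2) p. 174] [cite: FlathCorvallis1979, Thm. 3] -/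
theorem memXiFamily_of_keysTrichotomy_of_hasFinComponent (ξ : OneDimAutRepH L)
    (Ξ₀ : ∀ v : HeightOneSpectrum (𝓞 ↥(maximalRealSubfield L)), CMLocalAPacket L H v) (hΞ₀ : ξ.IsXiLocalFamily hH hHd μω hμu Ξ₀)
    (P : DiscreteAutomorphicRep (adelicGroupData (↥(maximalRealSubfield L)) L (IsCMField.complexConj L) 3 H) μA)
    {W : Type} [AddCommGroup W] [Module ℂ W] {σ : Representation ℂ (finAdelic (↥(maximalRealSubfield L)) L (IsCMField.complexConj L) 3 H) W}
    (hirr : σ.IsIrreducible) (hadm : σ.IsAdmissible) (hP : P.HasFinComponent σ)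
    (hTS : ∀ (v : HeightOneSpectrum (𝓞 ↥(maximalRealSubfield L))) (hs : ∃ w : PlacesOver L v, IsCMField.complexConj L • w.1 ≠ w.1)
      (c : IrrClass ((cmDatum L 3 H).Local v)),
      (IrrClass.comap (localPiEquiv L (IsCMField.complexConj L) 3 H v) c).IsConstituentOf
          (P.finRep.smoothPart.toRepresentation.comp (inclPlace (↥(maximalRealSubfield L)) L (IsCMField.complexConj L) 3 H v)) →
        c ∈ (Ξ₀ v).members)
    (hTN : ∀ (v : HeightOneSpectrum (𝓞 ↥(maximalRealSubfield L))), (∀ w : PlacesOver L v, IsCMField.complexConj L • w.1 = w.1) →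
      ∃ (T : GL (Fin 3) (LocalRing L v)) (a : LocalRing L v) (ha : IsUnit a)
        (h : formCongr (conjLocal L (IsCMField.complexConj L) v) T (H.map (algebraMap L (LocalRing L v))) =
          a • (Matrix.of fun i j : Fin 3 => if i.val + j.val + 1 = 3 then (1 : L) else 0).map (algebraMap L (LocalRing L v)))
        (π2 πn : IrrClass (Gqs L v)),
        KeysCaseTwoLabels L v (μω.semilocalComponent L v) (torusLocalComponent L (IsCMField.complexConj L) v ξ.η)
          (torusLocalComponent L (IsCMField.complexConj L) v ξ.ψ) π2 πn ∧
        ∀ c : IrrClass ((cmDatum L 3 H).Local v),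
          (IrrClass.comap (localPiEquiv L (IsCMField.complexConj L) 3 H v) c).IsConstituentOf
              (P.finRep.smoothPart.toRepresentation.comp (inclPlace (↥(maximalRealSubfield L)) L (IsCMField.complexConj L) 3 H v)) →
            c = IrrClass.comap (cmDatumLocalCongr L v T ha h).symm πn ∨ c = IrrClass.comap (cmDatumLocalCongr L v T ha h).symm π2 ∨ c.IsSupercuspidal) :
    MemXiFamily P hH hHd μω hμu ξ := by
  obtain ⟨π, -, hπ⟩ := exists_forall_isConstituentOf_iff_of_hasFinComponent L H P hirr hadm hP
  refine memXiFamily_of_keysTrichotomy_of_constituentClass L H hH hHd μω hμu ξ Ξ₀ hΞ₀ P π hπ (fun v hs => hTS v hs (π v) ((hπ v (π v)).2 rfl)) fun v hns => ?_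
  obtain ⟨T, a, ha, h, π2, πn, hK, htri⟩ := hTN v hns
  exact ⟨T, a, ha, h, π2, πn, hK, htri (π v) ((hπ v (π v)).2 rfl)⟩

set_option maxHeartbeats 400000 in -- measured ≤ 60k by `#count_heartbeats`; the default budget trips on this toolchain's accounting for the large binder types
/-- **THE TRICHOTOMY FORM FOR EVERY DISCRETE `P` OF `U(H)`, `H` ANISOTROPIC** — the head (γ2)'s payer hands over on A's frame (H definite at a complex place ⇒ anisotropic):
(T-S) + (T-N) on all constituents ⟹ `MemXiFamily P hH hHd μω hμu ξ`; the one-class-per-place input is discharged by ★ AFA at anisotropic `H`.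
[cite: Rogawski1990, §14.6 Thm. 14.6.4 p. 244; §13.1 Prop. 13.1.3 (d) p. 199; §12.2 (2) p. 174; §14.5 p. 237] [cite: FlathCorvallis1979, Thm. 3 and Thm. 4] -/
theorem memXiFamily_of_keysTrichotomy_of_anisotropic
    (hanis : ∀ x : Fin 3 → L, Literature.AlgebraicGeometry.ShimuraVarieties.hermForm (cmConjRingHom L) H x x = 0 → x = 0) (ξ : OneDimAutRepH L)
    (Ξ₀ : ∀ v : HeightOneSpectrum (𝓞 ↥(maximalRealSubfield L)), CMLocalAPacket L H v) (hΞ₀ : ξ.IsXiLocalFamily hH hHd μω hμu Ξ₀)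
    (P : DiscreteAutomorphicRep (adelicGroupData (↥(maximalRealSubfield L)) L (IsCMField.complexConj L) 3 H) μA)
    (hTS : ∀ (v : HeightOneSpectrum (𝓞 ↥(maximalRealSubfield L))) (hs : ∃ w : PlacesOver L v, IsCMField.complexConj L • w.1 ≠ w.1)
      (c : IrrClass ((cmDatum L 3 H).Local v)),
      (IrrClass.comap (localPiEquiv L (IsCMField.complexConj L) 3 H v) c).IsConstituentOf
          (P.finRep.smoothPart.toRepresentation.comp (inclPlace (↥(maximalRealSubfield L)) L (IsCMField.complexConj L) 3 H v)) →
        c ∈ (Ξ₀ v).members)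
    (hTN : ∀ (v : HeightOneSpectrum (𝓞 ↥(maximalRealSubfield L))), (∀ w : PlacesOver L v, IsCMField.complexConj L • w.1 = w.1) →
      ∃ (T : GL (Fin 3) (LocalRing L v)) (a : LocalRing L v) (ha : IsUnit a)
        (h : formCongr (conjLocal L (IsCMField.complexConj L) v) T (H.map (algebraMap L (LocalRing L v))) =
          a • (Matrix.of fun i j : Fin 3 => if i.val + j.val + 1 = 3 then (1 : L) else 0).map (algebraMap L (LocalRing L v)))
        (π2 πn : IrrClass (Gqs L v)),
        KeysCaseTwoLabels L v (μω.semilocalComponent L v) (torusLocalComponent L (IsCMField.complexConj L) v ξ.η)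
          (torusLocalComponent L (IsCMField.complexConj L) v ξ.ψ) π2 πn ∧
        ∀ c : IrrClass ((cmDatum L 3 H).Local v),
          (IrrClass.comap (localPiEquiv L (IsCMField.complexConj L) 3 H v) c).IsConstituentOf
              (P.finRep.smoothPart.toRepresentation.comp (inclPlace (↥(maximalRealSubfield L)) L (IsCMField.complexConj L) 3 H v)) →
            c = IrrClass.comap (cmDatumLocalCongr L v T ha h).symm πn ∨ c = IrrClass.comap (cmDatumLocalCongr L v T ha h).symm π2 ∨ c.IsSupercuspidal) :
    MemXiFamily P hH hHd μω hμu ξ := by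
  obtain ⟨W, _, _, σ, hirr, hadm, hP⟩ := automorphicFlathAdmissible_of_anisotropic L 3 H hanis μA P
  exact memXiFamily_of_keysTrichotomy_of_hasFinComponent L H hH hHd μω hμu ξ Ξ₀ hΞ₀ P hirr hadm hP hTS hTN

end Summit.HodgeConjecture.HodgeConjecture.R90.S5

end
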